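import Literature.Geometry.DiscreteGeometry.KissingRigidity
import Summits.AtomisticToContinuum.Crystallization.Theorems.PalmUnimodularRigidityShellsToBarlowChartCharts

/-!
# Combinatorial layering (B1a of `GapTwelveToBarlow`): vertex-figure tables and the quadrilateral inequality

Crux `SquareWellLayerCake.GapTwelveToBarlow` (stmt-AtomisticToContinuum-15807), line `Sketch`,
stub `stub_combinatorialLayering`; ingredients of the chart transfer lemma
(`…CombinatorialLayeringTransfer`):

* `transferTable_figure / _48 / _36 / _54` — finite facts (by `decide`) about the vertex figure
  of a label `p` in the two integer label tables `T = 3 • fccTab` (cuboctahedron, in `fcc3Int`)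
  and `T = hcpTab` (anticuboctahedron, `hcpInt`): two figure labels are at squared distance
  `18, 36, 48, 54`; `48` iff a third figure label is adjacent to both; a `36`-pair spans a link
  square whose fourth vertex is at squared distance `36` from the pole; a `54`-pair has a figure
  label adjacent to one end and at `36` from the other;
* `dist_sq_add_sq_le_four_of_quad` (anchor) — a bonded `4`-cycle with one diagonal `≥ 131/100`
  has the other diagonal `d` with `d² + (131/100)² ≤ 4` (from `|l − p + l' − m|² ≥ 0`).

Mathlib + the Literature tables `fccTab`, `hcpTab`; nothing is defined.
-/

namespace Summit.AtomisticToContinuum.Crystallization.Theorems.SquareWellLayerCakeGapTwelveToBarlow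

open Literature.Geometry.DiscreteGeometry

/-! ## Vertex-figure tables of the two patterns (by `decide`) -/

/-- In the vertex figure of a label `p` (labels adjacent to `p`), two distinct labels are at
squared distance `18, 36, 48` or `54`. [folklore] -/
theorem transferTable_figure {T : Fin 12 → Fin 3 → ℤ}
    (hT : (T = fun a : Fin 12 => 3 • fccTab a) ∨ T = hcpTab) :
    ∀ p t t' : Fin 12, t ≠ p → t' ≠ p → t ≠ t' →
      sqNormInt (T t - T p) = 18 → sqNormInt (T t' - T p) = 18 →
      sqNormInt (T t - T t') = 18 ∨ sqNormInt (T t - T t') = 36 ∨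
        sqNormInt (T t - T t') = 48 ∨ sqNormInt (T t - T t') = 54 := by
  rcases hT with rfl | rfl <;> decide

/-- In a vertex figure, a pair is at squared distance `48` iff a third figure label is adjacent
to both (the figure is `2K₂`, except at basal HCP labels where it is a path plus an isolated
label, the `48`-pair being the two ends of the path). [folklore] -/
theorem transferTable_48 {T : Fin 12 → Fin 3 → ℤ}
    (hT : (T = fun a : Fin 12 => 3 • fccTab a) ∨ T = hcpTab) :
    ∀ p t t' : Fin 12, t ≠ p → t' ≠ p → t ≠ t' →
      sqNormInt (T t - T p) = 18 → sqNormInt (T t' - T p) = 18 →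
      (sqNormInt (T t - T t') = 48 ↔ ∃ s : Fin 12, s ≠ p ∧ sqNormInt (T s - T p) = 18 ∧
        sqNormInt (T s - T t) = 18 ∧ sqNormInt (T s - T t') = 18) := by
  rcases hT with rfl | rfl <;> decide

/-- In a vertex figure, a `36`-pair spans a square of the link: some label OFF the closed figure
(the opposite vertex of the octahedron: squared distance `36` from the pole) is adjacent to
both. [folklore] -/
theorem transferTable_36 {T : Fin 12 → Fin 3 → ℤ}
    (hT : (T = fun a : Fin 12 => 3 • fccTab a) ∨ T = hcpTab) :
    ∀ p t t' : Fin 12,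
      sqNormInt (T t - T p) = 18 → sqNormInt (T t' - T p) = 18 → sqNormInt (T t - T t') = 36 →
      ∃ s : Fin 12, s ≠ p ∧ sqNormInt (T s - T p) = 36 ∧
        sqNormInt (T s - T t) = 18 ∧ sqNormInt (T s - T t') = 18 := by
  rcases hT with rfl | rfl <;> decide

/-- In a vertex figure, a `54`-pair has a figure label adjacent to one end and at squared
distance `36` from the other. [folklore] -/
theorem transferTable_54 {T : Fin 12 → Fin 3 → ℤ}
    (hT : (T = fun a : Fin 12 => 3 • fccTab a) ∨ T = hcpTab) :
    ∀ p t t' : Fin 12, t ≠ p → t' ≠ p → t ≠ t' →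
      sqNormInt (T t - T p) = 18 → sqNormInt (T t' - T p) = 18 → sqNormInt (T t - T t') = 54 →
      ∃ s : Fin 12, s ≠ p ∧ sqNormInt (T s - T p) = 18 ∧
        ((sqNormInt (T s - T t) = 18 ∧ sqNormInt (T s - T t') = 36) ∨
          (sqNormInt (T s - T t') = 18 ∧ sqNormInt (T s - T t) = 36)) := by
  rcases hT with rfl | rfl <;> decide

/-- Labels at positive squared distance are distinct. [folklore] -/
theorem ne_of_sqNormInt_sub_pos {T : Fin 12 → Fin 3 → ℤ} {a b : Fin 12} {n : ℤ}
    (h : sqNormInt (T a - T b) = n) (hn : 0 < n) : a ≠ b := by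
  rintro rfl
  rw [sub_self] at h
  have h0 : sqNormInt (0 : Fin 3 → ℤ) = 0 := by simp [sqNormInt]
  omega

/-! ## The quadrilateral inequality -/

/-- **The quadrilateral inequality with a long diagonal** (anchor of this file).  If `l ~ p ~ l' ~ m ~ l` is a
bonded `4`-cycle (sides `≤ 1`) whose diagonal `(p, m)` has length `≥ 131/100`, then the other
diagonal satisfies `|l l'|² + (131/100)² ≤ 4` (from `|l − p + l' − m|² ≥ 0`). [folklore] -/
theorem dist_sq_add_sq_le_four_of_quad :
    ∀ (l p l' m : EuclideanSpace ℝ (Fin 3)), dist l p ≤ 1 → dist p l' ≤ 1 → dist l' m ≤ 1 →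
    dist m l ≤ 1 → (131 : ℝ) / 100 ≤ dist p m → dist l l' ^ 2 + ((131 : ℝ) / 100) ^ 2 ≤ 4 := by
  intro l p l' m h1 h2 h3 h4 hpm
  have hA : dist l p = ‖l - p‖ := dist_eq_norm _ _
  have hB : dist p l' = ‖l' - p‖ := by rw [dist_comm, dist_eq_norm]
  have hC : dist p m = ‖m - p‖ := by rw [dist_comm, dist_eq_norm]
  have hAB : dist l l' = ‖(l - p) - (l' - p)‖ := by rw [dist_eq_norm, sub_sub_sub_cancel_right]
  have hBC : dist l' m = ‖(l' - p) - (m - p)‖ := by rw [dist_eq_norm, sub_sub_sub_cancel_right]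
  have hCA : dist m l = ‖(m - p) - (l - p)‖ := by rw [dist_eq_norm, sub_sub_sub_cancel_right]
  have key : dist l l' ^ 2 + dist p m ^ 2 ≤
      dist l p ^ 2 + dist p l' ^ 2 + dist l' m ^ 2 + dist m l ^ 2 := by
    rw [hA, hB, hC, hAB, hBC, hCA]
    have i1 := norm_sub_sq_real (l - p) (l' - p)
    have i2 := norm_sub_sq_real (l' - p) (m - p)
    have i3 := norm_sub_sq_real (m - p) (l - p)
    have i4 := norm_sub_sq_real ((l - p) + (l' - p)) (m - p)
    have i5 := norm_add_sq_real (l - p) (l' - p)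
    have i6 : inner ℝ ((l - p) + (l' - p)) (m - p) = inner ℝ (l - p) (m - p) + inner ℝ (l' - p) (m - p) :=
      inner_add_left _ _ _
    have i7 := real_inner_comm (m - p) (l - p)
    have i8 : 0 ≤ ‖(l - p) + (l' - p) - (m - p)‖ ^ 2 := sq_nonneg _
    linarith
  have d0 := dist_nonneg (x := l) (y := p)
  have d1 := dist_nonneg (x := p) (y := l')
  have d2 := dist_nonneg (x := l') (y := m)
  have d3 := dist_nonneg (x := m) (y := l)
  nlinarith

end Summit.AtomisticToContinuum.Crystallization.Theorems.SquareWellLayerCakeGapTwelveToBarlow
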